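import Summits.BirchSwinnertonDyer.Rank1Residual.X2.KeyCongruenceInvariants
import HarnessLib

/-!
# The single-level door's `lcongr` at level `m` is a UNIT CONGRUENCE: `(a) + (p)^m = (b) + (p)^m`
# in `Λ = ℤ_p⟦T⟧` if and only if `b ≡ a·u (mod p^m)` for a unit `u` (given `μ(a) < m`) — the
# shape in which a numerical Mazur–Tate certificate delivers it (cell `bsd-eis`, seat
# `bsd-eis-cgshw` g21; route `EisensteinPrimes`, crux 4 `BSDpOnCellC` / crux 3 `MazurMCOnCellB` ∩
# non-split; memo `HOME/cgshw-MEMO-24.md` §1 (d), §5)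

HONEST FRAMING (cell `bsd-eis`, run/shared/lean/pub/bsd-eis/): pure commutative algebra of
`Λ = ℤ_p⟦T⟧`, everything PROVED (Mathlib + the tree's `X1.MuLambda` / `X2.KeyCongruence` API);
nothing booked; X2 stays CONSTRUCTION-SHAPED; no label or count moves; BSD is proved for no curve.

## The point

`X2.CongruentMemberData.lcongr` (`X2/HigherWeightEisensteinTransfer.lean`) asks of the congruent
member `g` of depth `m` the equality of ideals `(L_g) + (p)^m = (f_E) + (p)^m`. The tree has the
forward implication «ideal congruence ⟹ `L_g ≡ u·f_E (mod p^m)` for a unit `u`»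
(`KeyCongruence.exists_isUnit_and_sub_mul_mem_of_span_sup_eq`, p533224) and, at `m = 1`, the
criterion «`μ = 0` on both sides and equal `λ`» (`LcongrAtLevelOne`, p558610). At the pairs where
the Hida family's Λ-adic symbol vanishes mod `(p, T)` (memo §1 (b)(iii): 1020e1, 660c1) `lcongr`
at `m ≥ 2` is NOT delivered by the family and has to be certified directly: what a computation
delivers is a polynomial `u` with unit constant term and `L_g ≡ u·f_E (mod p^m)` (memo §5, engine
`probe3e.gp`). This file records that this shape IS `lcongr` at level `m` — the converse direction
(elementary) and the resulting `iff` — in the door's own spelling.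

## Contents

* §1 `span_sup_span_C_pow_eq_of_isUnit_of_sub_mul_mem` — `u` a unit, `b − a·u ∈ (p^m)` ⟹
  `(a) + (p)^m = (b) + (p)^m`.
* §2 `span_sup_span_C_pow_eq_iff_exists_isUnit` — for `a ≠ 0`, `μ(a) < m`: the `iff`.
* §3 `lcongr_of_isUnit_of_eq_mul_add` — the certificate shape `L = u·f_E + p^m·c` ⟹ `lcongr` at `m`.

What this is NOT: not a statement about any `L`-function; not a proof of `lcongr` for any member
(the unit `u` and the congruence are INPUTS — numerically they come modulo `ω_n` only, memo §5).

References: [Skinner2016PacificMC] §3.1 (p. 192); [Washington1997] §7.1; [CastellaGrossiSkinner2025]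
proof of Thm. 7.2.3 (key congruence).
-/

set_option autoImplicit false
set_option linter.dupNamespace false

noncomputable section

open Literature.NumberTheory.EllipticCurves Summit.BirchSwinnertonDyer.Rank1Residual.X1.MuLambda
  Summit.BirchSwinnertonDyer.Rank1Residual.X2.KeyCongruence

namespace Summit.BirchSwinnertonDyer.BirchSwinnertonDyer.Theorems.LcongrIffUnitCongruence

variable {p : ℕ} [Fact p.Prime]

/-! ## §1. Unit congruence ⟹ ideal congruence -/

/-- **Unit congruence ⟹ ideal congruence.** If `u` is a unit of `Λ = ℤ_p⟦T⟧` and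
`b − a·u ∈ (p^m)`, then `(a) + (p)^m = (b) + (p)^m`: indeed `b = a u + p^m s` lies in `(a) + (p^m)`
and `a = b u⁻¹ − p^m s u⁻¹` lies in `(b) + (p^m)`. [cite: Skinner2016PacificMC, §3.1 (p. 192)] -/
theorem span_sup_span_C_pow_eq_of_isUnit_of_sub_mul_mem {a b u : IwasawaAlgebra p} (hu : IsUnit u)
    (m : ℕ)
    (h : b - a * u ∈ Ideal.span ({PowerSeries.C ((p : ℤ_[p]) ^ m)} : Set (IwasawaAlgebra p))) :
    Ideal.span ({a} : Set (IwasawaAlgebra p)) ⊔ (Ideal.span {PowerSeries.C (p : ℤ_[p])}) ^ m =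
      Ideal.span ({b} : Set (IwasawaAlgebra p)) ⊔ (Ideal.span {PowerSeries.C (p : ℤ_[p])}) ^ m := by
  rw [span_C_p_pow_eq]
  obtain ⟨s, hs⟩ := Ideal.mem_span_singleton'.mp h
  obtain ⟨w, hw⟩ := hu.exists_right_inv
  -- `b = u a + s p^m` and `a = w b − (s w) p^m`
  have hb : b = u * a + s * PowerSeries.C ((p : ℤ_[p]) ^ m) := by
    linear_combination (-1 : IwasawaAlgebra p) * hs
  have ha : a = w * b + (-(s * w)) * PowerSeries.C ((p : ℤ_[p]) ^ m) := by
    linear_combination w * hs - a * hw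
  apply le_antisymm
  · refine sup_le ?_ le_sup_right
    rw [Ideal.span_le, Set.singleton_subset_iff, SetLike.mem_coe, ha]
    exact Submodule.add_mem_sup (Ideal.mem_span_singleton'.mpr ⟨w, rfl⟩)
      (Ideal.mem_span_singleton'.mpr ⟨-(s * w), rfl⟩)
  · refine sup_le ?_ le_sup_right
    rw [Ideal.span_le, Set.singleton_subset_iff, SetLike.mem_coe, hb]
    exact Submodule.add_mem_sup (Ideal.mem_span_singleton'.mpr ⟨u, rfl⟩)
      (Ideal.mem_span_singleton'.mpr ⟨s, rfl⟩)

/-! ## §2. The `iff` at level `m` -/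

/-- **`lcongr` at level `m` ⟺ unit congruence mod `p^m`.** For `a ≠ 0` with `μ(a) < m`:
`(a) + (p)^m = (b) + (p)^m` holds if and only if `b ≡ a·u (mod p^m)` for some unit `u` of `Λ`.
(Forward: the tree's `KeyCongruence.exists_isUnit_and_sub_mul_mem_of_span_sup_eq`; backward: §1.)
[cite: Skinner2016PacificMC, §3.1 (p. 192)] [cite: Washington1997, §7.1] -/
theorem span_sup_span_C_pow_eq_iff_exists_isUnit {a b : IwasawaAlgebra p} (ha : a ≠ 0) {m : ℕ}
    (hm : mu a < m) :
    Ideal.span ({a} : Set (IwasawaAlgebra p)) ⊔ (Ideal.span {PowerSeries.C (p : ℤ_[p])}) ^ m =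
      Ideal.span ({b} : Set (IwasawaAlgebra p)) ⊔ (Ideal.span {PowerSeries.C (p : ℤ_[p])}) ^ m ↔
    ∃ u : IwasawaAlgebra p, IsUnit u ∧
      b - a * u ∈ Ideal.span ({PowerSeries.C ((p : ℤ_[p]) ^ m)} : Set (IwasawaAlgebra p)) := by
  constructor
  · exact exists_isUnit_and_sub_mul_mem_of_span_sup_eq ha hm
  · rintro ⟨u, hu, h⟩
    exact span_sup_span_C_pow_eq_of_isUnit_of_sub_mul_mem hu m h

/-! ## §3. The certificate shape -/

/-- **A numerical certificate's shape is `lcongr` at level `m`.** If `L = u·f_E + p^m·c` with `u` a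
unit of `Λ` (in practice: a polynomial with unit constant term modulo `(p^m, ω_n)`), then
`(L) + (p)^m = (f_E) + (p)^m` — the `lcongr` field of `X2.CongruentMemberData` at depth `m`.
(No hypothesis on `μ` is needed in this direction.) [cite: Skinner2016PacificMC, §3.1 (p. 192)] -/
theorem lcongr_of_isUnit_of_eq_mul_add {L fE u c : IwasawaAlgebra p} (hu : IsUnit u) (m : ℕ)
    (h : L = u * fE + PowerSeries.C ((p : ℤ_[p]) ^ m) * c) :
    Ideal.span ({L} : Set (IwasawaAlgebra p)) ⊔
        (Ideal.span {(PowerSeries.C (p : ℤ_[p]) : IwasawaAlgebra p)}) ^ m =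
      Ideal.span ({fE} : Set (IwasawaAlgebra p)) ⊔
        (Ideal.span {(PowerSeries.C (p : ℤ_[p]) : IwasawaAlgebra p)}) ^ m := by
  refine (span_sup_span_C_pow_eq_of_isUnit_of_sub_mul_mem (a := fE) (b := L) hu m ?_).symm
  exact Ideal.mem_span_singleton'.mpr ⟨c, by rw [h]; ring⟩

end Summit.BirchSwinnertonDyer.BirchSwinnertonDyer.Theorems.LcongrIffUnitCongruence

end
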